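import Mathlib.Analysis.Fourier.AddCircle
import Summits.RiemannHypothesis.RiemannHypothesis.Theorems.PfPersistenceGalerkinFormDecay
import HarnessLib

/-!
# GAL-1 piece (ii′), STEP B: window Fourier truncations of a test function

Cell `pub-rhpf` (even-sector Pólya-frequency campaign; a long-odds MECHANISM SEARCH — no RH claims),
seat `barrier-prover` g2. RH-free harmonic analysis; nothing about `RiemannHypothesis` is asserted.

For a half-length `a > 0` and `g : ℝ → ℂ` we set up the period-`2a` Fourier data of `g|[-a,a]`
WITHOUT a global `Fact (0 < 2a)` instance:

* `testCoeff a g n = (1/2a) ∫_{-a}^{a} e^{-2πinx/2a} g(x) dx` (`= fourierCoeff` of the `AddCircle (2a)` lift,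
  `testCoeff_eq_fourierCoeff`; `= fourierCoeffOn`, `testCoeff_eq_fourierCoeffOn`);
* `fourierTrunc a g N y = c₀ + Σ_{1 ≤ n ≤ N} c_n (e^{iω_n y} + e^{-iω_n y})`, `ω_n = 2πn/2a` — the symmetric
  partial sum written over `n : ℕ` using `c_{-n} = c_n` (valid for EVEN `g`, `testCoeff_neg`);
* EVEN `g` ⇒ `c_{-n} = c_n`; REAL `g` ⇒ `conj c_n = c_{-n}`; both ⇒ `c_n ∈ ℝ` (`conj_testCoeff_of_even_real`);
* CONVERGENCE ON THE WINDOW (`tendsto_fourierTrunc`): `g` continuous, even, `Σ ‖c_n‖ < ∞` ⇒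
  `fourierTrunc a g N y → g y` for every `y ∈ [-a, a]` (Mathlib `has_pointwise_sum_fourier_series_of_summable`
  + `HasSum.nat_add_neg`);
* SUP AND DERIVATIVE BOUNDS (`norm_fourierTrunc_le`, `hasDerivAt_fourierTrunc`, `norm_fourierTruncDeriv_le`);
* DECAY is in the companion file `PfPersistenceGalerkinFourierDecay` (three integrations by parts).
-/

noncomputable section

open Complex Filter Set MeasureTheory Topology Finset
open scoped Real ComplexConjugate Interval

namespace Summit.RiemannHypothesis.RiemannHypothesis.Theorems.PfPersistence

variable {a : ℝ} {g : ℝ → ℂ}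

/-! ## §1 Coefficients and truncations -/

/-- The `n`-th period-`2a` Fourier coefficient of `g` on the window `[-a, a]`. [folklore] -/
def testCoeff (a : ℝ) (g : ℝ → ℂ) (n : ℤ) : ℂ :=
  1 / (2 * a) * ∫ x in (-a)..a, cexp (2 * π * I * (-n) * x / (2 * a)) * g x

/-- The `n`-th symmetric term `c_n (e^{iω_n y} + e^{-iω_n y})` (`n ≥ 1`), `c₀` (`n = 0`). [folklore] -/
def fourierTerm (a : ℝ) (g : ℝ → ℂ) (n : ℕ) (y : ℝ) : ℂ :=
  if n = 0 then testCoeff a g 0 else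
    testCoeff a g n * (cexp (2 * π * I * n * y / (2 * a)) + cexp (2 * π * I * (-n) * y / (2 * a)))

/-- The symmetric Fourier truncation `P_N g (y) = Σ_{n ≤ N} fourierTerm n y`. [folklore] -/
def fourierTrunc (a : ℝ) (g : ℝ → ℂ) (N : ℕ) (y : ℝ) : ℂ :=
  ∑ n ∈ Finset.range (N + 1), fourierTerm a g n y

/-! ## §2 Dictionary with Mathlib's `AddCircle` Fourier theory -/

/-- `testCoeff = fourierCoeffOn` on `[-a, a]`. [folklore] -/
theorem testCoeff_eq_fourierCoeffOn (hab : -a < a) (g : ℝ → ℂ) (n : ℤ) :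
    testCoeff a g n = fourierCoeffOn hab g n := by
  rw [fourierCoeffOn_eq_integral, testCoeff]
  simp_rw [fourier_coe_apply, smul_eq_mul]
  rw [Complex.real_smul]
  congr 1
  · push_cast; ring
  · refine intervalIntegral.integral_congr fun x _ ↦ ?_
    congr 2
    push_cast
    ring

/-- `testCoeff = fourierCoeff` of the `AddCircle (2a)` lift of `g|[-a, a)`. [folklore] -/
theorem testCoeff_eq_fourierCoeff [hT : Fact (0 < 2 * a)] (g : ℝ → ℂ) (n : ℤ) :
    fourierCoeff (AddCircle.liftIco (2 * a) (-a) g) n = testCoeff a g n := by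
  rw [fourierCoeff_liftIco_eq, fourierCoeffOn_eq_integral, testCoeff]
  have h1 : -a + 2 * a = a := by ring
  simp_rw [fourier_coe_apply, smul_eq_mul]
  rw [Complex.real_smul, h1]
  congr 1
  · push_cast; ring
  · refine intervalIntegral.integral_congr fun x _ ↦ ?_
    congr 2
    push_cast
    ring

/-! ## §3 Even and real tests: `c_{-n} = c_n ∈ ℝ` -/

/-- EVEN `g` ⇒ `c_{-n} = c_n`. [folklore] -/
theorem testCoeff_neg (hg : ∀ x, g (-x) = g x) (n : ℤ) :
    testCoeff a g (-n) = testCoeff a g n := by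
  unfold testCoeff
  congr 1
  have h := intervalIntegral.integral_comp_neg (a := -a) (b := a)
    (f := fun x : ℝ ↦ cexp (2 * π * I * (-n) * x / (2 * a)) * g x)
  simp only [neg_neg] at h
  rw [← h]
  refine intervalIntegral.integral_congr fun x _ ↦ ?_
  simp only [hg]
  congr 1
  push_cast
  ring_nf

/-- REAL `g` ⇒ `conj c_n = c_{-n}`. [folklore] -/
theorem conj_testCoeff (ha : 0 < a) (hg : ∀ x, conj (g x) = g x) (n : ℤ) :
    conj (testCoeff a g n) = testCoeff a g (-n) := by
  unfold testCoeff
  rw [map_mul]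
  congr 1
  · rw [map_div₀, map_one, map_mul, map_ofNat, Complex.conj_ofReal]
  · rw [intervalIntegral.integral_of_le (by linarith), intervalIntegral.integral_of_le (by linarith),
      ← integral_conj]
    refine setIntegral_congr_fun measurableSet_Ioc fun x _ ↦ ?_
    simp only [map_mul, hg]
    congr 1
    rw [← Complex.exp_conj]
    congr 1
    simp only [map_mul, map_div₀, map_neg, Complex.conj_ofReal, Complex.conj_I, map_intCast,
      map_ofNat]
    push_cast
    ring

/-- EVEN REAL `g` ⇒ `c_n` is real: `conj c_n = c_n`. [folklore] -/
theorem conj_testCoeff_of_even_real (ha : 0 < a) (hge : ∀ x, g (-x) = g x)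
    (hgr : ∀ x, conj (g x) = g x) (n : ℤ) : conj (testCoeff a g n) = testCoeff a g n := by
  rw [conj_testCoeff ha hgr, testCoeff_neg hge]

/-! ## §4 Convergence on the window -/

/-- The symmetric exponential partial sum equals the cosine-form truncation plus `c₀` (EVEN `g`).
[folklore] -/
theorem sum_range_exp_eq_fourierTrunc_add [Fact (0 < 2 * a)] (hge : ∀ x, g (-x) = g x) (N : ℕ)
    (y : ℝ) :
    ∑ n ∈ Finset.range (N + 1),
        (testCoeff a g n * fourier (n : ℤ) (y : AddCircle (2 * a)) +
          testCoeff a g (-(n : ℤ)) * fourier (-(n : ℤ)) (y : AddCircle (2 * a))) =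
      fourierTrunc a g N y + testCoeff a g 0 := by
  have hF : ∀ n : ℕ, testCoeff a g n * fourier (n : ℤ) (y : AddCircle (2 * a)) +
      testCoeff a g (-(n : ℤ)) * fourier (-(n : ℤ)) (y : AddCircle (2 * a)) =
      fourierTerm a g n y + if n = 0 then testCoeff a g 0 else 0 := by
    intro n
    by_cases hn : n = 0
    · subst hn
      simp only [fourierTerm, if_true, Nat.cast_zero, neg_zero, fourier_coe_apply]
      push_cast
      simp
    · rw [fourierTerm, if_neg hn, if_neg hn, add_zero, testCoeff_neg hge, fourier_coe_apply,
        fourier_coe_apply, mul_add]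
      push_cast
      ring_nf
  simp_rw [hF, Finset.sum_add_distrib, Finset.sum_ite_eq' (Finset.range (N + 1)) 0,
    Finset.mem_range, Nat.succ_pos, if_true]
  rfl

/-- **Convergence of the window Fourier truncations**: for `g` continuous and even with absolutely
summable window coefficients, `P_N g (y) → g(y)` for every `y ∈ [-a, a]`. [folklore] -/
theorem tendsto_fourierTrunc (ha : 0 < a) (hgc : Continuous g) (hge : ∀ x, g (-x) = g x)
    (hs : Summable fun n : ℤ ↦ ‖testCoeff a g n‖) {y : ℝ} (hy : y ∈ Icc (-a) a) :
    Tendsto (fun N ↦ fourierTrunc a g N y) atTop (𝓝 (g y)) := by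
  haveI : Fact (0 < 2 * a) := ⟨by linarith⟩
  have hper : g (-a) = g (-a + 2 * a) := by
    rw [show -a + 2 * a = a by ring, hge a]
  set gC : C(AddCircle (2 * a), ℂ) :=
    ⟨AddCircle.liftIco (2 * a) (-a) g, AddCircle.liftIco_continuous hper hgc.continuousOn⟩ with hgC
  have hcoef : ∀ n, fourierCoeff gC n = testCoeff a g n := fun n ↦ testCoeff_eq_fourierCoeff g n
  have hsum : Summable (fourierCoeff gC) :=
    Summable.of_norm_bounded hs fun n ↦ by rw [hcoef]
  have hval : gC (y : AddCircle (2 * a)) = g y := by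
    rcases hy.2.lt_or_eq with hlt | heq
    · exact AddCircle.liftIco_coe_apply ⟨hy.1, by linarith⟩
    · have hp := AddCircle.coe_add_period (2 * a) (-a)
      rw [show -a + 2 * a = a by ring] at hp
      rw [heq, show (gC : AddCircle (2 * a) → ℂ) = AddCircle.liftIco (2 * a) (-a) g from rfl, hp,
        AddCircle.liftIco_coe_apply ⟨le_rfl, by linarith⟩, hge a]
  have hHS := has_pointwise_sum_fourier_series_of_summable hsum (y : AddCircle (2 * a))
  rw [hval] at hHS
  have h3 := (hHS.nat_add_neg).tendsto_sum_nat
  -- `Σ_{n<N} (F n + F (-n)) → g y + F 0`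
  have hF0 : fourierCoeff gC 0 • fourier 0 (y : AddCircle (2 * a)) = testCoeff a g 0 := by
    rw [hcoef, fourier_zero, smul_eq_mul, mul_one]
  rw [hF0] at h3
  have h4 : (fun N ↦ fourierTrunc a g N y) = fun N ↦
      (∑ n ∈ Finset.range (N + 1), (fourierCoeff gC n • fourier (n : ℤ) (y : AddCircle (2 * a)) +
        fourierCoeff gC (-(n : ℤ)) • fourier (-(n : ℤ)) (y : AddCircle (2 * a)))) -
        testCoeff a g 0 := by
    funext N
    simp_rw [hcoef, smul_eq_mul, sum_range_exp_eq_fourierTrunc_add hge N y]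
    ring
  rw [h4]
  have h5 := (h3.comp (tendsto_add_atTop_nat 1)).sub_const (testCoeff a g 0)
  simpa using h5

/-! ## §5 Sup bound, derivative and derivative bound of the truncations -/

/-- `‖e^{2πi n y/2a}‖ = 1`. [folklore] -/
theorem norm_cexp_freq (a : ℝ) (n : ℂ) (hn : n.im = 0) (y : ℝ) :
    ‖cexp (2 * π * I * n * y / (2 * a))‖ = 1 := by
  have e : 2 * π * I * n * y / (2 * a) = ((2 * π * n.re * y / (2 * a) : ℝ) : ℂ) * I := by
    have hn' : n = (n.re : ℂ) := by
      apply Complex.ext <;> simp [hn]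
    rw [hn']
    push_cast
    simp only [Complex.ofReal_re]
    ring
  rw [e, Complex.norm_exp_ofReal_mul_I]

/-- `‖fourierTerm n y‖ ≤ 2 ‖c_n‖`. [folklore] -/
theorem norm_fourierTerm_le (a : ℝ) (g : ℝ → ℂ) (n : ℕ) (y : ℝ) :
    ‖fourierTerm a g n y‖ ≤ 2 * ‖testCoeff a g n‖ := by
  unfold fourierTerm
  split_ifs with hn
  · subst hn; simp; linarith [norm_nonneg (testCoeff a g 0)]
  · rw [norm_mul, mul_comm]
    refine mul_le_mul_of_nonneg_right ?_ (norm_nonneg _)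
    refine (norm_add_le _ _).trans ?_
    have h1 := norm_cexp_freq a (n : ℂ) (by simp) y
    have h2 := norm_cexp_freq a (-(n : ℂ)) (by simp) y
    rw [h1, h2]; norm_num

/-- **Sup bound**: `‖P_N g (y)‖ ≤ 2 Σ_n ‖c_n‖`. [folklore] -/
theorem norm_fourierTrunc_le (hs : Summable fun n : ℕ ↦ ‖testCoeff a g n‖) (N : ℕ) (y : ℝ) :
    ‖fourierTrunc a g N y‖ ≤ 2 * ∑' n : ℕ, ‖testCoeff a g n‖ := by
  unfold fourierTrunc
  calc ‖∑ n ∈ Finset.range (N + 1), fourierTerm a g n y‖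
      ≤ ∑ n ∈ Finset.range (N + 1), ‖fourierTerm a g n y‖ := norm_sum_le _ _
    _ ≤ ∑ n ∈ Finset.range (N + 1), 2 * ‖testCoeff a g n‖ :=
        Finset.sum_le_sum fun n _ ↦ norm_fourierTerm_le a g n y
    _ = 2 * ∑ n ∈ Finset.range (N + 1), ‖testCoeff a g n‖ := by rw [Finset.mul_sum]
    _ ≤ 2 * ∑' n : ℕ, ‖testCoeff a g n‖ := by
        gcongr
        exact hs.sum_le_tsum _ fun n _ ↦ norm_nonneg _

/-- `d/dy e^{c y} = c e^{c y}` along the real line. [folklore] -/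
theorem hasDerivAt_cexp_const_mul_ofReal (c : ℂ) (y : ℝ) :
    HasDerivAt (fun y : ℝ ↦ cexp (c * y)) (c * cexp (c * y)) y := by
  have h : HasDerivAt (fun z : ℂ ↦ cexp (c * z)) (cexp (c * y) * (c * 1)) (y : ℂ) :=
    ((hasDerivAt_id (y : ℂ)).const_mul c).cexp
  have h' := h.comp_ofReal
  simpa [mul_comm] using h'

/-- The derivative of the `n`-th symmetric term. [folklore] -/
def fourierTermDeriv (a : ℝ) (g : ℝ → ℂ) (n : ℕ) (y : ℝ) : ℂ :=
  if n = 0 then 0 else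
    testCoeff a g n * (2 * π * I * n / (2 * a) * cexp (2 * π * I * n * y / (2 * a)) +
      2 * π * I * (-n) / (2 * a) * cexp (2 * π * I * (-n) * y / (2 * a)))

/-- The derivative of the truncation `P_N g`. [folklore] -/
def fourierTruncDeriv (a : ℝ) (g : ℝ → ℂ) (N : ℕ) (y : ℝ) : ℂ :=
  ∑ n ∈ Finset.range (N + 1), fourierTermDeriv a g n y

/-- `d/dy fourierTerm n = fourierTermDeriv n`. [folklore] -/
theorem hasDerivAt_fourierTerm (a : ℝ) (g : ℝ → ℂ) (n : ℕ) (y : ℝ) :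
    HasDerivAt (fourierTerm a g n) (fourierTermDeriv a g n y) y := by
  unfold fourierTerm fourierTermDeriv
  split_ifs with hn
  · exact hasDerivAt_const _ _
  · have e : ∀ (m : ℂ) (y : ℝ), cexp (2 * π * I * m * y / (2 * a)) =
        cexp (2 * π * I * m / (2 * a) * y) := fun m y ↦ by congr 1; ring
    simp_rw [e]
    exact ((hasDerivAt_cexp_const_mul_ofReal _ y).add
      (hasDerivAt_cexp_const_mul_ofReal _ y)).const_mul _

/-- `d/dy P_N g = fourierTruncDeriv N`. [folklore] -/
theorem hasDerivAt_fourierTrunc (a : ℝ) (g : ℝ → ℂ) (N : ℕ) (y : ℝ) :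
    HasDerivAt (fourierTrunc a g N) (fourierTruncDeriv a g N y) y := by
  unfold fourierTruncDeriv
  have h := HasDerivAt.fun_sum (u := Finset.range (N + 1))
    (A := fun n y ↦ fourierTerm a g n y) (A' := fun n ↦ fourierTermDeriv a g n y) (x := y)
    fun n _ ↦ hasDerivAt_fourierTerm a g n y
  have e : fourierTrunc a g N = fun y ↦ ∑ n ∈ Finset.range (N + 1), fourierTerm a g n y :=
    funext fun z ↦ rfl
  rw [e]
  exact h

/-- The derivative of the truncation is continuous. [folklore] -/
theorem continuous_fourierTruncDeriv (a : ℝ) (g : ℝ → ℂ) (N : ℕ) :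
    Continuous (fourierTruncDeriv a g N) := by
  unfold fourierTruncDeriv fourierTermDeriv
  refine continuous_finsetSum _ fun n _ ↦ ?_
  split_ifs
  · exact continuous_const
  · fun_prop

/-- `‖fourierTermDeriv n y‖ ≤ (2π/a) · n ‖c_n‖` (`a > 0`). [folklore] -/
theorem norm_fourierTermDeriv_le (ha : 0 < a) (g : ℝ → ℂ) (n : ℕ) (y : ℝ) :
    ‖fourierTermDeriv a g n y‖ ≤ 2 * π / a * (n * ‖testCoeff a g n‖) := by
  unfold fourierTermDeriv
  split_ifs with hn
  · simp; positivity
  · rw [norm_mul]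
    have h1 := norm_cexp_freq a (n : ℂ) (by simp) y
    have h2 := norm_cexp_freq a (-(n : ℂ)) (by simp) y
    have hω : ‖2 * π * I * (n : ℂ) / (2 * a)‖ = π * n / a := by
      rw [norm_div, norm_mul, norm_mul, norm_mul, Complex.norm_I, Complex.norm_natCast,
        Complex.norm_real, Complex.norm_ofNat, Real.norm_of_nonneg Real.pi_pos.le, norm_mul,
        Complex.norm_ofNat, Complex.norm_real, Real.norm_of_nonneg ha.le]
      field_simp
    have hω' : ‖2 * π * I * (-(n : ℂ)) / (2 * a)‖ = π * n / a := by
      rw [show 2 * π * I * (-(n : ℂ)) / (2 * a) = -(2 * π * I * (n : ℂ) / (2 * a)) by ring,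
        norm_neg, hω]
    calc ‖testCoeff a g n‖ * ‖2 * π * I * n / (2 * a) * cexp (2 * π * I * n * y / (2 * a)) +
          2 * π * I * (-n) / (2 * a) * cexp (2 * π * I * (-n) * y / (2 * a))‖
        ≤ ‖testCoeff a g n‖ * (π * n / a + π * n / a) := by
          refine mul_le_mul_of_nonneg_left ((norm_add_le _ _).trans ?_) (norm_nonneg _)
          rw [norm_mul, norm_mul, h1, h2, hω, hω']; simp
      _ = 2 * π / a * (n * ‖testCoeff a g n‖) := by ring

/-- **Derivative bound**: `‖(P_N g)'(y)‖ ≤ (2π/a) Σ_n n ‖c_n‖`. [folklore] -/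
theorem norm_fourierTruncDeriv_le (ha : 0 < a)
    (hs : Summable fun n : ℕ ↦ (n : ℝ) * ‖testCoeff a g n‖) (N : ℕ) (y : ℝ) :
    ‖fourierTruncDeriv a g N y‖ ≤ 2 * π / a * ∑' n : ℕ, (n : ℝ) * ‖testCoeff a g n‖ := by
  unfold fourierTruncDeriv
  calc ‖∑ n ∈ Finset.range (N + 1), fourierTermDeriv a g n y‖
      ≤ ∑ n ∈ Finset.range (N + 1), ‖fourierTermDeriv a g n y‖ := norm_sum_le _ _
    _ ≤ ∑ n ∈ Finset.range (N + 1), 2 * π / a * (n * ‖testCoeff a g n‖) :=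
        Finset.sum_le_sum fun n _ ↦ norm_fourierTermDeriv_le ha g n y
    _ = 2 * π / a * ∑ n ∈ Finset.range (N + 1), (n : ℝ) * ‖testCoeff a g n‖ := by
        rw [Finset.mul_sum]
    _ ≤ 2 * π / a * ∑' n : ℕ, (n : ℝ) * ‖testCoeff a g n‖ := by
        gcongr
        exact hs.sum_le_tsum _ fun n _ ↦ by positivity

end Summit.RiemannHypothesis.RiemannHypothesis.Theorems.PfPersistence
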